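import Summits.QuantumFields.YangMills.Theorems.UnitScaleTiltProp7CombTrueStepDefectTwoBlock
import Summits.QuantumFields.YangMills.Theorems.UnitScaleTiltProp7CornerCombFlatPieces
import HarnessLib

/-!
# (n3)-COMB (II), row `hMcomb₂`, located difficulty H2-1 — THE THREE POINTWISE ROWS THAT FEED THE `ℓ¹` ENGINE (`…CornerCombL1Engine`) AT A UNITARY BACKGROUND TOWER:
# (p1) one-step domination of the reduced tower `G`, (p2) the corner frame reads the block, (p3) the structure bound

Crux `stmt-QuantumFields-19200` `MinimiserStabilityRegPr`, route-R E′ (A′)-on-Σ, P-A2 (β); supplier design (II) (★routeR-w1 g9 MASTER 6efb31c3 §4: H2-1; §1 row 4 «DEF_j = O(α_j)»);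
★px17 g4's H-line (H-4b: `hMcomb₂ ⟸ H2-1(E) ⟸` per-(l, j) `ℓ¹` bounds of the homogeneous propagations of tied sources).  Width seat `ym3-torus-px18` (gen 4);
`--kind proof --supports stmt-QuantumFields-19200 --as helper`; THEOREMS ONLY (0 `def`, 0 `sorry`); «(O2) groundwork — not consumed by any displayed row before the freeze lifts»;
count-neutral.  YM₃ on T³ is a ladder rung (R3), not Clay; nothing here is progress on the YM mass gap.

## The point
`…CornerCombL1Engine.sum_norm_le_localised_of_pointwise` knits the `ℓ¹` of a cornered tower from three POINTWISE hypotheses.  Here they are discharged, generically on `ℤᵈ`, for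
✓p704390 `cornerComb_structure`'s families with the corner map `CM_k(G) z := FhatCov L Ūᵏ G (L•z)` at a UNITARY-valued background tower (transports are isometries, lit ✓`norm_conjR_le`):
(p1) `‖G_{k+1}(z,κ)‖ ≤ L⁻ᵈ·Σ_{r,t<L}‖G_k(L•z + r + t•e_κ) κ‖ + 210·α_k·(2d+2)L·Σ_{s,ν}(‖G_k(L•z + s) ν‖ + ‖G_k(L•z + L•e_κ + s) ν‖)` — ✓F-5b `norm_trueStep_defect_le_twoBlock` (the
`F̂`-terms of the split CANCEL against the subtracted covariant gradient of `CM_k(G_k)` by lit `avgIter_succ`), the straight term by the per-step walk bound, `√(two-block ℓ²) ≤` two-block `ℓ¹`;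
(p2) `‖FhatCov L V A y‖ ≤ Σ_r L⁻ᵈ·Σ_{steps of treeWord r from y}‖A(step)‖` (forward words, per-step walk bound); (p3) `‖Q_k(z,κ)‖ ≤ ‖G_k(z,κ)‖ + ‖Λ_k z‖ + ‖Λ_k(z + e_κ)‖`.

## What is here (ns `…Theorems.Prop7CornerCombL1PointwiseRows`)
* §1 WALK ROWS (`U1`-valued transports): ★ `norm_tsum_le_sum_steps` (forward word: `‖(R_{0,x}A)(w)‖ ≤ Σ_{steps}‖A(step)‖`), `sum_steps_seg_eq` (the steps of `seg κ L` from `p` are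
  `(p + t•e_κ, κ)`, `t < L`), ★ `norm_tsum_seg_le`, ★ `norm_smul_Q0cov_le` (`‖L • Q0cov L V A q κ‖ ≤ L⁻ᵈ·Σ_{r,t<L}‖A(q + r + t•e_κ) κ‖`), `sqrt_sum_sum_sq_add_sq_le` (`√ΣΣ(a²+b²) ≤ ΣΣ(a+b)`).
* §2 ★★ `norm_FhatCov_le_sum_steps` = (p2).
* §3 ★★★ `norm_reduced_succ_le_pointwise` = (p1), with ✓p704390's `hGs` text at `CM k G z := FhatCov L (avgIter L U₀ k) G ((L:ℤ) • z)` as the displayed recursion hypothesis.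
* §4 ★ `norm_le_of_structure_pointwise` = (p3) (any identity `Q = Gk + (Λ z − Ad_u Λ(z + e κ))`, `u ∈ U1`).
DEPENDENCE: constants `L⁻ᵈ`, `210·α·(2d+2)L` only.  NOT HERE: the absorbing chains ∕ period cells, the loop windows `α_k ≤ 1∕24` from `RegPr` (★routeR-w6 ✓`comb_level_rows_of_regPr`), the
unitarity of the averaged tower (★px17 ✓p701438∕✓p702610), the localised-mass pricing (✓p705643∕✓p706697∕✓p709510) — member file.
HONEST: pointwise norm bookkeeping; nothing of H2-1's member ∕ `hMcomb₂` ∕ `hMcomb` ∕ (β) ∕ the crux is proved or claimed; rung R3 (YM₃ on T³), NOT d = 4, NOT infinite volume, NOT Clay;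
YM gap NOT proved.  References: T. Bałaban, CMP 98 (1985) 17–51 [Balaban1985Averaging] ((42)–(43) pp.23–24, (58) p.27, (112) p.34, (119) p.35, (125)–(126) p.36).
-/

set_option autoImplicit false

noncomputable section

open scoped BigOperators
open Finset

namespace Summit.QuantumFields.YangMills.Theorems.Prop7CornerCombL1PointwiseRows

open NormedSpace
open Literature.MathematicalPhysics.QuantumFieldTheory.Balaban1983to89
open ExpMeanLog (eml)
open B7Prop1Explicit (Site Letter e hol stepHol seg treeWord boxVec gammaWord Wcx Xavg bavg expUnit U1 hol_mem stepHol_mem seg_natCast)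
open B7Prop2Explicit (avgIter unitaryUnits unitaryUnits_le_U1 avgIter_succ rescale_apply)
open B7Eq78Linearization (conjR conjR_apply)
open B7Prop3GeneralRotated (tsum tstep tsum_cons tsum_nil norm_conjR_le)
open B7Prop3GeneralLinear (FhatCov Q0cov)
open Summit.QuantumFields.YangMills.Theorems.Prop7CombHolRatioPerStep (zip_scanl_cons zip_scanl_nil)
open Summit.QuantumFields.YangMills.Theorems.Prop7CornerCombFlatPieces (snd_eq_true_of_mem_treeWord_boxVec)
open Summit.QuantumFields.YangMills.Theorems.Prop7CombTrueStepDefectTwoBlock (norm_trueStep_defect_le_twoBlock)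

/-! ## §1 Walk rows at a `U1`-valued transport -/

section Walk

variable {d : ℕ} {𝔸 : Type*} [NormedRing 𝔸] [NormOneClass 𝔸]

/-- ★ **PER-STEP WALK BOUND** (forward words): for `V₀` with values in `U1` and a word `w` of forward letters,
`‖(R_{0,x}A)(w)‖ ≤ Σ_{s ∈ steps(w from x)}‖A s.1 s.2.1‖` — the rotations do not increase norms (lit ✓`norm_conjR_le`), each forward letter contributes `A` at its start site.
[cite: Balaban1985Averaging, (58) p.27, (125)–(126) p.36] -/
theorem norm_tsum_le_sum_steps {V₀ : Site d → Fin d → 𝔸ˣ} (hV₀ : ∀ x κ, V₀ x κ ∈ U1 𝔸) (A : Site d → Fin d → 𝔸) :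
    ∀ (x : Site d) (w : List (Letter d)), (∀ l ∈ w, l.2 = true) →
      ‖tsum V₀ A x w‖ ≤ ((List.zip (List.scanl (fun (z : Site d) (l' : Letter d) => z + l'.vec) x w) w).map fun s => ‖A s.1 s.2.1‖).sum
  | x, [], _ => by rw [zip_scanl_nil]; simp
  | x, l :: w, hw => by
    rw [zip_scanl_cons, List.map_cons, List.sum_cons, tsum_cons]
    have hl : l.2 = true := hw l (by simp)
    have hw' : ∀ l' ∈ w, l'.2 = true := fun l' hl' => hw l' (by simp [hl'])
    have hstep : tstep V₀ A x l = A x l.1 := by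
      unfold tstep; rw [if_pos hl]
    refine (norm_add_le _ _).trans (add_le_add (by rw [hstep]) ?_)
    exact (norm_conjR_le (stepHol_mem hV₀ x l) _).trans (norm_tsum_le_sum_steps hV₀ A (x + l.vec) w hw')

omit [NormOneClass 𝔸] in
/-- the steps of the forward segment `seg κ n` from `p` contribute `Σ_{t<n}‖A(p + t•e_κ) κ‖`. [folklore] [cite: Balaban1985Averaging, (9) p.18] -/
theorem sum_steps_seg_eq (A : Site d → Fin d → 𝔸) (κ : Fin d) :
    ∀ (n : ℕ) (p : Site d),
      ((List.zip (List.scanl (fun (z : Site d) (l' : Letter d) => z + l'.vec) p (List.replicate n ((κ, true) : Letter d)))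
          (List.replicate n ((κ, true) : Letter d))).map fun s => ‖A s.1 s.2.1‖).sum
        = ∑ t ∈ Finset.range n, ‖A (p + (t : ℤ) • e κ) κ‖
  | 0, p => by simp
  | n + 1, p => by
    rw [List.replicate_succ, zip_scanl_cons, List.map_cons, List.sum_cons, sum_steps_seg_eq A κ n (p + Letter.vec (κ, true)),
      Finset.sum_range_succ', Nat.cast_zero, zero_smul, add_zero, add_comm]
    congr 1
    refine Finset.sum_congr rfl fun t _ => ?_
    rw [B7Prop1Explicit.Letter.vec_true, add_assoc, Nat.cast_succ, add_smul, one_smul, add_comm ((t : ℤ) • e κ)]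

/-- ★ `‖(R_{0,p}A)([p, p + L e_κ])‖ ≤ Σ_{t<L}‖A(p + t•e_κ) κ‖`. [cite: Balaban1985Averaging, (125)–(126) p.36] -/
theorem norm_tsum_seg_le {V₀ : Site d → Fin d → 𝔸ˣ} (hV₀ : ∀ x κ, V₀ x κ ∈ U1 𝔸) (A : Site d → Fin d → 𝔸) (p : Site d) (κ : Fin d) (L : ℕ) :
    ‖tsum V₀ A p (seg κ (L : ℤ))‖ ≤ ∑ t ∈ Finset.range L, ‖A (p + (t : ℤ) • e κ) κ‖ := by
  rw [seg_natCast, ← sum_steps_seg_eq A κ L p]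
  exact norm_tsum_le_sum_steps hV₀ A p _ (fun l hl => by rw [(List.eq_of_mem_replicate hl)])

/-- `√(Σ_iΣ_j (a_ij² + b_ij²)) ≤ Σ_iΣ_j (a_ij + b_ij)` for nonnegative families (two-block `ℓ²` ≤ two-block `ℓ¹`). [folklore] -/
theorem sqrt_sum_sum_sq_add_sq_le {ι ι' : Type*} [Fintype ι] [Fintype ι'] (a b : ι → ι' → ℝ) (ha : ∀ i j, 0 ≤ a i j) (hb : ∀ i j, 0 ≤ b i j) :
    Real.sqrt (∑ i, ∑ j, (a i j ^ 2 + b i j ^ 2)) ≤ ∑ i, ∑ j, (a i j + b i j) := by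
  set S : ℝ := ∑ i, ∑ j, (a i j + b i j) with hS
  have hij : ∀ i j, a i j + b i j ≤ S := by
    intro i j
    calc a i j + b i j ≤ ∑ j', (a i j' + b i j') :=
          Finset.single_le_sum (f := fun j' => a i j' + b i j') (fun j' _ => add_nonneg (ha i j') (hb i j')) (Finset.mem_univ j)
      _ ≤ S := Finset.single_le_sum (f := fun i' => ∑ j', (a i' j' + b i' j'))
          (fun i' _ => Finset.sum_nonneg fun j' _ => add_nonneg (ha i' j') (hb i' j')) (Finset.mem_univ i)
  have hS0 : 0 ≤ S := Finset.sum_nonneg fun i _ => Finset.sum_nonneg fun j _ => add_nonneg (ha i j) (hb i j)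
  rw [Real.sqrt_le_left hS0]
  calc ∑ i, ∑ j, (a i j ^ 2 + b i j ^ 2) ≤ ∑ i, ∑ j, (a i j + b i j) * S :=
        Finset.sum_le_sum fun i _ => Finset.sum_le_sum fun j _ => by
          have := hij i j; have := ha i j; have := hb i j; nlinarith
    _ = S ^ 2 := by rw [hS, sq, Finset.sum_mul]; exact Finset.sum_congr rfl fun i _ => by rw [Finset.sum_mul]

end Walk

/-! ## §2 (p2): the corner frame reads the block -/

section Frame

variable {d : ℕ} {𝔸 : Type*} [NormedRing 𝔸] [NormOneClass 𝔸] [NormedAlgebra ℂ 𝔸]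

/-- ★★ **(p2) THE CORNER FRAME READS THE BLOCK**: for `V` with values in `U1`,
`‖FhatCov L V A y‖ ≤ Σ_r L⁻ᵈ·Σ_{s ∈ steps(treeWord (boxVec L r) from y)}‖A s.1 s.2.1‖` (the tree words are forward; §1). [cite: Balaban1985Averaging, (112) p.34, (14) p.19] -/
theorem norm_FhatCov_le_sum_steps (L : ℕ) {V : Site d → Fin d → 𝔸ˣ} (hV : ∀ x κ, V x κ ∈ U1 𝔸) (A : Site d → Fin d → 𝔸) (y : Site d) :
    ‖FhatCov L V A y‖ ≤ ∑ r : Fin d → Fin L, ((L : ℝ) ^ d)⁻¹ *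
      ((List.zip (List.scanl (fun (z : Site d) (l' : Letter d) => z + l'.vec) y (treeWord (boxVec L r))) (treeWord (boxVec L r))).map
        fun s => ‖A s.1 s.2.1‖).sum := by
  have hc0 : 0 ≤ ((L : ℝ) ^ d)⁻¹ := by positivity
  unfold FhatCov
  refine (norm_sum_le _ _).trans (Finset.sum_le_sum fun r _ => ?_)
  refine (norm_smul_le _ _).trans ?_
  rw [Real.norm_of_nonneg hc0]
  exact mul_le_mul_of_nonneg_left (norm_tsum_le_sum_steps hV A y _ fun l hl => snd_eq_true_of_mem_treeWord_boxVec L r hl) hc0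

/-- ★ `‖L • Q0cov L V A q κ‖ ≤ L⁻ᵈ·Σ_{r,t<L}‖A(q + r + t•e_κ) κ‖` — the straight main term of the split: rotations are non-expansive, the segment by §1, `L·L^{−(d+1)} = L⁻ᵈ`.
[cite: Balaban1985Averaging, (125)–(126) p.36] -/
theorem norm_smul_Q0cov_le (L : ℕ) (hL : 1 ≤ L) {V : Site d → Fin d → 𝔸ˣ} (hV : ∀ x κ, V x κ ∈ U1 𝔸) (A : Site d → Fin d → 𝔸) (q : Site d) (κ : Fin d) :
    ‖(L : ℝ) • Q0cov L V A q κ‖ ≤ ((L : ℝ) ^ d)⁻¹ * ∑ r : Fin d → Fin L, ∑ t ∈ Finset.range L, ‖A (q + boxVec L r + (t : ℤ) • e κ) κ‖ := by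
  have hL0 : (0 : ℝ) < L := by exact_mod_cast hL
  have hc0 : 0 ≤ ((L : ℝ) ^ (d + 1))⁻¹ := by positivity
  have hterm : ∀ r : Fin d → Fin L,
      ‖(((L : ℝ) ^ (d + 1))⁻¹) • conjR (hol V q (treeWord (boxVec L r))) (tsum V A (q + boxVec L r) (seg κ (L : ℤ)))‖
        ≤ ((L : ℝ) ^ (d + 1))⁻¹ * ∑ t ∈ Finset.range L, ‖A (q + boxVec L r + (t : ℤ) • e κ) κ‖ := by
    intro r
    refine (norm_smul_le _ _).trans ?_
    rw [Real.norm_of_nonneg hc0]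
    refine mul_le_mul_of_nonneg_left ?_ hc0
    exact (norm_conjR_le (hol_mem hV _ _) _).trans (norm_tsum_seg_le hV A (q + boxVec L r) κ L)
  unfold Q0cov
  rw [Finset.smul_sum]
  calc ‖∑ r : Fin d → Fin L, (L : ℝ) • ((((L : ℝ) ^ (d + 1))⁻¹) • conjR (hol V q (treeWord (boxVec L r))) (tsum V A (q + boxVec L r) (seg κ (L : ℤ))))‖
      ≤ ∑ r : Fin d → Fin L, (L : ℝ) * (((L : ℝ) ^ (d + 1))⁻¹ * ∑ t ∈ Finset.range L, ‖A (q + boxVec L r + (t : ℤ) • e κ) κ‖) := by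
        refine (norm_sum_le _ _).trans (Finset.sum_le_sum fun r _ => ?_)
        refine (norm_smul_le _ _).trans ?_
        rw [Real.norm_of_nonneg hL0.le]
        exact mul_le_mul_of_nonneg_left (hterm r) hL0.le
    _ = ((L : ℝ) ^ d)⁻¹ * ∑ r : Fin d → Fin L, ∑ t ∈ Finset.range L, ‖A (q + boxVec L r + (t : ℤ) • e κ) κ‖ := by
        rw [Finset.mul_sum]
        refine Finset.sum_congr rfl fun r _ => ?_
        rw [← mul_assoc, pow_succ, mul_inv, mul_comm (L : ℝ), mul_assoc (((L : ℝ) ^ d)⁻¹), inv_mul_cancel₀ hL0.ne', mul_one]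

end Frame

/-! ## §3 (p1): one-step domination of the reduced tower at a unitary background -/

section Reduced

variable {d : ℕ} {𝔸 : Type*} [CStarAlgebra 𝔸] [Nontrivial 𝔸]

/-- ★★★ **(p1) ONE-STEP DOMINATION OF THE REDUCED TOWER**: at level `k`, with `V₀ := Ū₀ᵏ = avgIter L U₀ k` UNITARY-valued, block loops `‖W(V₀)(L•z,κ,r) − 1‖ ≤ α ≤ 1∕24`, and the
reduced family of ✓`cornerComb_structure` with the corner map `CM_k(G) z := FhatCov L Ūᵏ G (L•z)` (its `hGs` text displayed verbatim at this `CM`):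
`‖G (k+1) z κ‖ ≤ L⁻ᵈ·Σ_{r,t<L}‖G k (L•z + r + t•e_κ) κ‖ + 210·α·(2d+2)L·Σ_{s,ν}(‖G k (L•z + s) ν‖ + ‖G k (L•z + L•e_κ + s) ν‖)` — the `F̂`-terms of ✓F-5a's split CANCEL against the
subtracted covariant gradient of `CM_k(G_k)` (lit `avgIter_succ`: `Ū^{k+1}(z,κ) = bavg L Ūᵏ (L•z) κ`), leaving `L•Q0cov` (§2) + the defect (✓F-5b). «(O2) groundwork.»
[cite: Balaban1985Averaging, (42)–(43) pp.23–24, (119) p.35, (124)–(126) p.36] -/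
theorem norm_reduced_succ_le_pointwise (L : ℕ) (hL : 1 ≤ L) (U₀ : Site d → Fin d → 𝔸ˣ) (k : ℕ)
    (hV : ∀ x μ, avgIter L U₀ k x μ ∈ unitaryUnits 𝔸)
    (G : ℕ → Site d → Fin d → 𝔸)
    (hGs : ∀ (z : Site d) (κ : Fin d), G (k + 1) z κ
      = (fderiv ℂ (eml : ((Fin d → Fin L) → 𝔸) → 𝔸) (fun r => ((Wcx L (avgIter L U₀ k) ((L : ℤ) • z) κ (boxVec L r) : 𝔸ˣ) : 𝔸))
            (fun r => tsum (avgIter L U₀ k) (G k) ((L : ℤ) • z) (gammaWord L κ (boxVec L r) ++ seg κ (-(L : ℤ)))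
              * ((Wcx L (avgIter L U₀ k) ((L : ℤ) • z) κ (boxVec L r) : 𝔸ˣ) : 𝔸))
            * (((expUnit (Xavg L (avgIter L U₀ k) ((L : ℤ) • z) κ))⁻¹ : 𝔸ˣ) : 𝔸)
          + ((expUnit (Xavg L (avgIter L U₀ k) ((L : ℤ) • z) κ) : 𝔸ˣ) : 𝔸) * tsum (avgIter L U₀ k) (G k) ((L : ℤ) • z) (seg κ (L : ℤ))
            * (((expUnit (Xavg L (avgIter L U₀ k) ((L : ℤ) • z) κ))⁻¹ : 𝔸ˣ) : 𝔸))
        - (FhatCov L (avgIter L U₀ k) (G k) ((L : ℤ) • z)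
            - conjR (avgIter L U₀ (k + 1) z κ) (FhatCov L (avgIter L U₀ k) (G k) ((L : ℤ) • (z + e κ)))))
    {α : ℝ} (hα : ∀ (z : Site d) (κ : Fin d) (r : Fin d → Fin L), ‖((Wcx L (avgIter L U₀ k) ((L : ℤ) • z) κ (boxVec L r) : 𝔸ˣ) : 𝔸) - 1‖ ≤ α)
    (hα24 : α ≤ 1 / 24) (z : Site d) (κ : Fin d) :
    ‖G (k + 1) z κ‖ ≤
      ((L : ℝ) ^ d)⁻¹ * ∑ r : Fin d → Fin L, ∑ t ∈ Finset.range L, ‖G k ((L : ℤ) • z + boxVec L r + (t : ℤ) • e κ) κ‖ +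
        (210 * α * ((2 * d + 2) * L)) * ∑ s : Fin d → Fin L, ∑ ν : Fin d,
          (‖G k ((L : ℤ) • z + boxVec L s) ν‖ + ‖G k ((L : ℤ) • z + (L : ℤ) • e κ + boxVec L s) ν‖) := by
  have hV' : ∀ x μ, avgIter L U₀ k x μ ∈ U1 𝔸 := fun x μ => unitaryUnits_le_U1 (hV x μ)
  -- the level-(k+1) bond variable is the block average of level k at the corner `L•z`
  have havg : avgIter L U₀ (k + 1) z κ = bavg L (avgIter L U₀ k) ((L : ℤ) • z) κ := by rw [avgIter_succ, rescale_apply]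
  have hqe : (L : ℤ) • (z + e κ) = (L : ℤ) • z + (L : ℤ) • e κ := smul_add _ _ _
  -- the defect of ✓F-5b at (L•z, κ)
  have hdef := norm_trueStep_defect_le_twoBlock L hL (avgIter L U₀ k) hV (G k) ((L : ℤ) • z) κ (fun r => hα z κ r) hα24
  have h210 : 0 ≤ 210 * α * ((2 * d + 2) * L) := by
    have hα0 : 0 ≤ α := le_trans (norm_nonneg _) (hα z κ (fun _ => ⟨0, hL⟩))
    positivity
  have hsqrt : Real.sqrt (∑ s : Fin d → Fin L, ∑ ν : Fin d,
        (‖G k ((L : ℤ) • z + boxVec L s) ν‖ ^ 2 + ‖G k ((L : ℤ) • z + (L : ℤ) • e κ + boxVec L s) ν‖ ^ 2))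
      ≤ ∑ s : Fin d → Fin L, ∑ ν : Fin d, (‖G k ((L : ℤ) • z + boxVec L s) ν‖ + ‖G k ((L : ℤ) • z + (L : ℤ) • e κ + boxVec L s) ν‖) := by
    exact sqrt_sum_sum_sq_add_sq_le (fun s ν => ‖G k ((L : ℤ) • z + boxVec L s) ν‖)
      (fun s ν => ‖G k ((L : ℤ) • z + (L : ℤ) • e κ + boxVec L s) ν‖) (fun _ _ => norm_nonneg _) (fun _ _ => norm_nonneg _)
  -- `G (k+1) z κ = (split defect) + L • Q0cov`: the `F̂`-terms cancel (`X − Y = (X − (Y + E)) + E`)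
  have key : G (k + 1) z κ
      = (fderiv ℂ (eml : ((Fin d → Fin L) → 𝔸) → 𝔸) (fun r => ((Wcx L (avgIter L U₀ k) ((L : ℤ) • z) κ (boxVec L r) : 𝔸ˣ) : 𝔸))
            (fun r => tsum (avgIter L U₀ k) (G k) ((L : ℤ) • z) (gammaWord L κ (boxVec L r) ++ seg κ (-(L : ℤ)))
              * ((Wcx L (avgIter L U₀ k) ((L : ℤ) • z) κ (boxVec L r) : 𝔸ˣ) : 𝔸))
            * (((expUnit (Xavg L (avgIter L U₀ k) ((L : ℤ) • z) κ))⁻¹ : 𝔸ˣ) : 𝔸)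
          + ((expUnit (Xavg L (avgIter L U₀ k) ((L : ℤ) • z) κ) : 𝔸ˣ) : 𝔸) * tsum (avgIter L U₀ k) (G k) ((L : ℤ) • z) (seg κ (L : ℤ))
            * (((expUnit (Xavg L (avgIter L U₀ k) ((L : ℤ) • z) κ))⁻¹ : 𝔸ˣ) : 𝔸)
          - (FhatCov L (avgIter L U₀ k) (G k) ((L : ℤ) • z)
              - conjR (bavg L (avgIter L U₀ k) ((L : ℤ) • z) κ) (FhatCov L (avgIter L U₀ k) (G k) ((L : ℤ) • z + (L : ℤ) • e κ))
              + (L : ℝ) • Q0cov L (avgIter L U₀ k) (G k) ((L : ℤ) • z) κ))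
        + (L : ℝ) • Q0cov L (avgIter L U₀ k) (G k) ((L : ℤ) • z) κ := by
    rw [hGs z κ, havg, hqe, sub_add_eq_sub_sub, sub_add_cancel]
  rw [key]
  refine (norm_add_le _ _).trans ?_
  rw [add_comm]
  refine add_le_add (norm_smul_Q0cov_le L hL hV' (G k) ((L : ℤ) • z) κ) (hdef.trans ?_)
  calc 210 * α * ((2 * d + 2) * L * Real.sqrt (∑ s : Fin d → Fin L, ∑ ν : Fin d,
          (‖G k ((L : ℤ) • z + boxVec L s) ν‖ ^ 2 + ‖G k ((L : ℤ) • z + (L : ℤ) • e κ + boxVec L s) ν‖ ^ 2)))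
      = (210 * α * ((2 * d + 2) * L)) * Real.sqrt (∑ s : Fin d → Fin L, ∑ ν : Fin d,
          (‖G k ((L : ℤ) • z + boxVec L s) ν‖ ^ 2 + ‖G k ((L : ℤ) • z + (L : ℤ) • e κ + boxVec L s) ν‖ ^ 2)) := by ring
    _ ≤ (210 * α * ((2 * d + 2) * L)) * ∑ s : Fin d → Fin L, ∑ ν : Fin d,
          (‖G k ((L : ℤ) • z + boxVec L s) ν‖ + ‖G k ((L : ℤ) • z + (L : ℤ) • e κ + boxVec L s) ν‖) :=
        mul_le_mul_of_nonneg_left hsqrt h210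

end Reduced

/-! ## §4 (p3): the structure bound -/

section Structure

variable {d : ℕ} {𝔸 : Type*} [NormedRing 𝔸] [NormOneClass 𝔸]

/-- ★ **(p3) THE STRUCTURE BOUND**: from ✓`cornerComb_structure`'s identity `Q = Gk + (Λ z − Ad_u Λ(z + e κ))` with `u ∈ U1`, `‖Q‖ ≤ ‖Gk‖ + ‖Λ z‖ + ‖Λ(z + e κ)‖`.
[cite: Balaban1985Averaging, (42)–(43) pp.23–24, (56)–(57) p.27] -/
theorem norm_le_of_structure_pointwise {u : 𝔸ˣ} (hu : u ∈ U1 𝔸) {Q Gk Λz Λz' : 𝔸} (hQ : Q = Gk + (Λz - conjR u Λz')) :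
    ‖Q‖ ≤ ‖Gk‖ + ‖Λz‖ + ‖Λz'‖ := by
  rw [hQ]
  calc ‖Gk + (Λz - conjR u Λz')‖ ≤ ‖Gk‖ + ‖Λz - conjR u Λz'‖ := norm_add_le _ _
    _ ≤ ‖Gk‖ + (‖Λz‖ + ‖conjR u Λz'‖) := add_le_add le_rfl (norm_sub_le _ _)
    _ ≤ ‖Gk‖ + (‖Λz‖ + ‖Λz'‖) := add_le_add le_rfl (add_le_add le_rfl (norm_conjR_le hu _))
    _ = ‖Gk‖ + ‖Λz‖ + ‖Λz'‖ := by ring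

end Structure

end Summit.QuantumFields.YangMills.Theorems.Prop7CornerCombL1PointwiseRows

end
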